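import Summits.AnomalousDissipation.AnomalousDissipation.Theses.MomentParity

/-!
# `MomentParity.LadderGlue` (stmt-AnomalousDissipation-14285): proof

`Summit.AnomalousDissipation.AnomalousDissipation.Theses.MomentParity.LadderGlue` is the pure-logic
glue of the clause split of the route target:
`GalerkinInvariantLoud → ResolvedDissipation → MomentLadder`.

Proof (`ladderGlue_proof`): unpack the force `f`, the viscosities `ν j → 0` and the budgets `E, ε`
from `GalerkinInvariantLoud`; at each `j` take its support radius `R` and the resolution schedule
`κ` that `ResolvedDissipation` assigns to `(f, ν j, R)`; inside the `∃ᶠ N` (`Filter.Frequently.mono`)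
the loud Galerkin-invariant measure `μ` is `d`-stationary for every order `d` (the degree hypothesis
`P.totalDegree + 1 ≤ d` is simply dropped) and its mean enstrophy is `κ`-resolved by
`ResolvedDissipation` applied to `μ` itself. This is the body of `MomentLadder` verbatim.
Source of the route step: FMRT 2001 (Foias–Manley–Rosa–Temam), Ch. IV.
-/

-- `Summit.<Summit>.<Problem>` is the tree's mandated summit-side namespace (CONVENTIONS §2); for this
-- single-conjunct summit the two coincide, so the duplicate is deliberate.
set_option linter.dupNamespace false

namespace Summit.AnomalousDissipation.AnomalousDissipation.Theorems

open Summit.AnomalousDissipation.AnomalousDissipation.Theses.MomentParity in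
/-- **Glue of the clause split of route `MomentParity`** (item stmt-AnomalousDissipation-14285):
`GalerkinInvariantLoud → ResolvedDissipation → MomentLadder`.
Pure logic: the witnesses `(f, ν, E, ε)` and, per `j`, the radius `R` come from
`GalerkinInvariantLoud`; the schedule `κ` comes from `ResolvedDissipation` at `(f, ν j, R)`; the
frequently-many loud invariant measures serve every moment order `d` (degree hypothesis dropped) and
are `κ`-resolved. [route AnomalousDissipation/MomentParity; FMRT2001 Ch. IV] -/
theorem ladderGlue_proof :
    Summit.AnomalousDissipation.AnomalousDissipation.Theses.MomentParity.LadderGlue := by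
  unfold LadderGlue GalerkinInvariantLoud ResolvedDissipation MomentLadder
  intro hG hR
  obtain ⟨f, hfs, hfd, hfz, ν, E, ε, hν, hν0, hε, hj⟩ := hG
  refine ⟨f, hfs, hfd, hfz, ν, E, ε, hν, hν0, hε, fun j => ?_⟩
  obtain ⟨R, hfreq⟩ := hj j
  obtain ⟨κ, hκ⟩ := hR f hfs hfd hfz (ν j) (hν j) R
  refine ⟨R, κ, hfreq.mono fun N hN d => ?_⟩
  obtain ⟨μ, hμ, hsupp, hball, hstat, hE, hD⟩ := hN
  exact ⟨μ, hμ, hsupp, hball, hκ N μ hμ hsupp hball hstat, fun m g P hg _ => hstat m g P hg, hE, hD⟩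

end Summit.AnomalousDissipation.AnomalousDissipation.Theorems
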